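import Summits.ValiantsHypothesis.ValiantsHypothesis.Theorems.NewtonUnitEquationsTwoProductsPlanarCellBlockMerge
import Summits.ValiantsHypothesis.ValiantsHypothesis.Theorems.NewtonUnitEquationsTwoProductsFormalLogLinearisationEngineCommonConeRung
import HarnessLib

/-!
# The CORNER SQUEEZE — val-idea-37 g6 (crux `TwoProducts`, stmt-ValiantsHypothesis-5906; lens «open-question harvest»)

Harvested question: val-neg-1 g8's Conjecture N / §5 «(T)+N squeeze, heuristic except (T)» / §6 «a proof of N (slope 1) or of the slope-2
form» (`pub/val-lit/neg/neg1g8/memo/NULL-CORNER.md`): «every hull vertex beyond the first pocket is paid for by ONE vanishing generic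
coefficient — MASS CANCELLATION, slope 1».  This file PROVES the slope-1 squeeze in the currency of the line of record (log-visible points of
`D = Σ_j log(1+u_j) − Σ_j log(1+v_j)`, valid weights, `PlanarCellBound`), GLOBALLY, for the natural kill count — the GENUINE ONE-LETTER SHADOW:

* `global_corner_squeeze` (THE RESULT): for EVERY finite family `S` of log-visible points,
  `#S ≤ #(S ∩ letters) + #genShadow S + #letters · (#letters − 1)`; with `t`-sparse tails `#S ≤ 2mt + (2mt)² + #genShadow S`
  (`global_corner_squeeze_sparse`).  Here `genShadow S` = the points `l − a` (`l ∈ S`, `a` a letter of a factor `w`, `l − a` an ACTUAL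
  support point of a positive power of `w`), each of which is a GENUINE CANCELLATION: `D_{l−a} = 0` although its fibre is non-empty
  (`cell_corner_squeeze_genuine`, `coShadow_killed`).  Slope exactly `1`, intercept quadratic in the alphabet; nothing is assumed about cells.
* Mechanism — three elementary facts about strict tops under valid weights (all letters of negative weight):
  (K1) `sdiff_subset_image_fst_genPairs`: a top outside the alphabet has a genuine pair (`coeff_l (w^r) ≠ 0`, `r ≥ 2`, splits `l = x + a`,
  `x ∈ supp (w^{r−1})`);  (K2) `shadow_kill` ⊂ idea-34 g10's box locality L1: `l − a` is strictly heavier than `l`, hence killed;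
  (K5) PRIVACY `eq_of_shadow_eq`: two tops whose witnesses order the letters alike never share a shadow point — if `l − a = l' − a'` then the
  witness of `l` ranks `a` STRICTLY above `a'` and the witness of `l'` ranks `a'` strictly above `a`;  (K6) NO PARALLELOGRAMS
  `eq_of_add_eq_add_of_tops`: valid tops `w₁ + w₄ = w₂ + w₃`, `w₁ ≠ w₂` force `w₁ = w₃` (pure sign lemma `four_tops_false` in `ℝ²`: the four
  witnesses would have the sign patterns `(−,−),(+,−),(−,+),(+,+)` on `(w₂−w₁, w₃−w₁)` yet all be negative on a letter).  By (K5)+(K6) two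
  letters `a ≠ a'` charge a common shadow point for at most ONE shadow point in total (`card_collisions_le`), so the charging
  `(l, a) ↦ l − a` is injective up to `#letters(#letters−1)` collisions (`card_le_card_image_add_card_collisions`).
* Per cell (one weak order `R` on the letters, `IsCellFamily`) privacy is exact: `cell_corner_squeeze` `#S ≤ #(S ∩ letters) + #coShadow S`,
  `#shadowPairs S = #coShadow S`; `card_le_two_sums`: the visible letters-or-2-sums number `≤ 2·#letters` per cell (linear, not quadratic).
* Currency statements: `coShadowBound_iff_planarCellBound`, `genShadowBound_iff_planarCellBound` (per cell, both directions) and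
  `twoProducts_of_globalGenShadowBound` : `GlobalGenShadowBound → …Theses.NewtonUnitEquations.TwoProducts` via the landed
  `twoProducts_of_planarCellBound` (p596451): the crux follows from ONE count — «the genuine killed one-letter shadow of any family of
  log-visible points has `≤ 2^{am}(t+2)^b` points».

Honest framing: structure + counting, 0 sorry; nothing here bounds `#genShadow S`.  `PlanarCellBound`, `ResidualLawV25`, the crux `TwoProducts`
and `closes` are UNMOVED (v25 @c11a592d1404, 1 sorry `stub_residual`); VP ≠ VNP is NOT proved.  No instances, no notation, no named literature
facts; sole imports = two tree Theorems files + HarnessLib. [folklore]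
-/

noncomputable section

-- Sub = Summit single-conjunct layout: the duplicated namespace component is mandated by the tree.
set_option linter.dupNamespace false

open scoped BigOperators Classical
open MvPolynomial
open Summit.ValiantsHypothesis.ValiantsHypothesis.Theorems.NewtonUnitEquations.TwoProducts.FormalLogLinearisation
open Summit.ValiantsHypothesis.ValiantsHypothesis.Theorems.NewtonUnitEquations.TwoProducts.PlanarCell

namespace Summit.ValiantsHypothesis.ValiantsHypothesis.Cruxes.TwoProducts.CornerSqueeze

variable {m : ℕ}

/-! ## Letters: membership, weight, the letter below a support point -/

theorem mem_tailSupport_of_mem_support_u (u v : Fin m → MvPolynomial (Fin 2) ℂ) (j : Fin m) {a : Expo}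
    (ha : a ∈ (u j).support) : a ∈ tailSupport u v :=
  Finset.mem_union.2 (Or.inl (Finset.mem_biUnion.2 ⟨j, Finset.mem_univ _, ha⟩))

theorem mem_tailSupport_of_mem_support_v (u v : Fin m → MvPolynomial (Fin 2) ℂ) (j : Fin m) {a : Expo}
    (ha : a ∈ (v j).support) : a ∈ tailSupport u v :=
  Finset.mem_union.2 (Or.inr (Finset.mem_biUnion.2 ⟨j, Finset.mem_univ _, ha⟩))

/-- Letters have negative weight under a valid weight. [folklore] -/
theorem wt_neg_of_mem_tailSupport {u v : Fin m → MvPolynomial (Fin 2) ℂ} {ξ : Fin 2 → ℝ} (hval : ValidWeight u v ξ)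
    {a : Expo} (ha : a ∈ tailSupport u v) : wt ξ a < 0 := by
  rcases Finset.mem_union.1 ha with h | h
  · obtain ⟨j, -, hj⟩ := Finset.mem_biUnion.1 h
    exact hval.1 j a hj
  · obtain ⟨j, -, hj⟩ := Finset.mem_biUnion.1 h
    exact hval.2 j a hj

/-- In the presence of a valid weight, letters are nonzero. [folklore] -/
theorem ne_zero_of_mem_tailSupport {u v : Fin m → MvPolynomial (Fin 2) ℂ} {ξ : Fin 2 → ℝ} (hval : ValidWeight u v ξ)
    {a : Expo} (ha : a ∈ tailSupport u v) : a ≠ 0 := by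
  rintro rfl
  have h := wt_neg_of_mem_tailSupport hval ha
  rw [wt_zero] at h
  exact lt_irrefl _ h

/-- The tail support of a `t`-sparse instance has at most `2mt` letters. [folklore] -/
theorem card_tailSupport_le_two_mul (u v : Fin m → MvPolynomial (Fin 2) ℂ) (t : ℕ) (hu : ∀ j, (u j).support.card ≤ t)
    (hv : ∀ j, (v j).support.card ≤ t) : (tailSupport u v).card ≤ 2 * m * t := by
  unfold tailSupport
  have h1 : (Finset.univ.biUnion fun j => (u j).support).card ≤ m * t :=
    calc (Finset.univ.biUnion fun j => (u j).support).card ≤ ∑ j, (u j).support.card := Finset.card_biUnion_le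
      _ ≤ ∑ _j : Fin m, t := Finset.sum_le_sum fun j _ => hu j
      _ = m * t := by simp
  have h2 : (Finset.univ.biUnion fun j => (v j).support).card ≤ m * t :=
    calc (Finset.univ.biUnion fun j => (v j).support).card ≤ ∑ j, (v j).support.card := Finset.card_biUnion_le
      _ ≤ ∑ _j : Fin m, t := Finset.sum_le_sum fun j _ => hv j
      _ = m * t := by simp
  calc _ ≤ (Finset.univ.biUnion fun j => (u j).support).card + (Finset.univ.biUnion fun j => (v j).support).card :=
        Finset.card_union_le _ _
    _ ≤ m * t + m * t := add_le_add h1 h2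
    _ = 2 * m * t := by ring

/-- A nonzero coefficient of `w ^ r`, `r ≥ 1`, at `n` forces a monomial of `w` coordinatewise below `n`. [folklore] -/
theorem exists_mem_support_le_of_coeff_pow_ne_zero (w : MvPolynomial (Fin 2) ℂ) (r : ℕ) (hr : 1 ≤ r) (n : Expo)
    (hn : coeff n (w ^ r) ≠ 0) : ∃ a ∈ w.support, a ≤ n := by
  obtain ⟨k, rfl⟩ : ∃ k, r = k + 1 := ⟨r - 1, by omega⟩
  rw [pow_succ] at hn
  have hmem : n ∈ (w ^ k * w).support := mem_support_iff.2 hn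
  obtain ⟨x, -, a, ha, hxa⟩ := Finset.mem_add.1 (support_mul _ _ hmem)
  exact ⟨a, ha, hxa ▸ le_add_self⟩

/-- **Letter below.** Every point of the log-support `supp D` dominates a letter coordinatewise. [folklore] -/
theorem exists_letter_le_of_mem_logSupport {u v : Fin m → MvPolynomial (Fin 2) ℂ} {n : Expo}
    (hn : n ∈ logSupport u v) : ∃ a ∈ tailSupport u v, a ≤ n := by
  obtain ⟨j, ⟨r, hr, hc⟩ | ⟨r, hr, hc⟩⟩ := exists_mem_support_of_mem_logSupport hn
  · obtain ⟨a, ha, hle⟩ := exists_mem_support_le_of_coeff_pow_ne_zero (u j) r hr n hc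
    exact ⟨a, mem_tailSupport_of_mem_support_u u v j ha, hle⟩
  · obtain ⟨a, ha, hle⟩ := exists_mem_support_le_of_coeff_pow_ne_zero (v j) r hr n hc
    exact ⟨a, mem_tailSupport_of_mem_support_v u v j ha, hle⟩

/-! ## Locality: the shadow of a top is killed -/

/-- `0 ≤ l` coordinatewise. [folklore] -/
theorem expo_zero_le (l : Expo) : (0 : Expo) ≤ l := Finsupp.le_def.2 fun _ => Nat.zero_le _

/-- Weight of a coordinatewise difference. [folklore] -/
theorem wt_tsub (ξ : Fin 2 → ℝ) {a l : Expo} (hal : a ≤ l) : wt ξ (l - a) = wt ξ l - wt ξ a := by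
  have h := wt_add ξ (l - a) a
  rw [tsub_add_cancel_of_le hal] at h
  linarith

/-- Coordinatewise differences from the same point determine the subtrahend. [folklore] -/
theorem eq_of_tsub_eq_tsub {l a a' : Expo} (hal : a ≤ l) (hal' : a' ≤ l) (h : l - a = l - a') : a = a' := by
  ext i
  have h1 := congrArg (fun f : Expo => f i) h
  simp only [Finsupp.tsub_apply] at h1
  have h2 := Finsupp.le_def.1 hal i
  have h3 := Finsupp.le_def.1 hal' i
  omega

/-- **Shadow kill (locality, any cell).** If `l` is the strict `ξ`-top of `supp D` for a valid weight `ξ` and `a ≤ l` is a letter,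
then `l − a` is strictly `ξ`-heavier than `l`; consequently `l − a ∉ supp D`, i.e. the log-coefficient at `l − a` VANISHES. [folklore] -/
theorem shadow_kill {u v : Fin m → MvPolynomial (Fin 2) ℂ} {ξ : Fin 2 → ℝ} (hval : ValidWeight u v ξ) {l : Expo}
    (htop : IsStrictTop ξ (logSupport u v) l) {a : Expo} (ha : a ∈ tailSupport u v) (hal : a ≤ l) :
    wt ξ l < wt ξ (l - a) ∧ logDiff u v (l - a) = 0 := by
  have hwa := wt_neg_of_mem_tailSupport hval ha
  have hlt : wt ξ l < wt ξ (l - a) := by rw [wt_tsub ξ hal]; linarith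
  refine ⟨hlt, ?_⟩
  by_contra hne
  have hmem : l - a ∈ logSupport u v := hne
  have hne' : l - a ≠ l := by
    intro h
    have h' : l - a = l - 0 := by rw [h, tsub_zero]
    exact ne_zero_of_mem_tailSupport hval ha (eq_of_tsub_eq_tsub hal (expo_zero_le l) h')
  exact lt_irrefl _ ((htop.2 (l - a) hmem hne').trans hlt)

/-- **Deep shadow kill.** The same for `l − c`, `c = Σ_{i∈s} g i` a NONEMPTY finite sum of letters with `c ≤ l`. [folklore] -/
theorem deepShadow_kill {u v : Fin m → MvPolynomial (Fin 2) ℂ} {ξ : Fin 2 → ℝ} (hval : ValidWeight u v ξ) {l : Expo}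
    (htop : IsStrictTop ξ (logSupport u v) l) {ι : Type*} (s : Finset ι) (hs : s.Nonempty) (g : ι → Expo)
    (hg : ∀ i ∈ s, g i ∈ tailSupport u v) (hcl : ∑ i ∈ s, g i ≤ l) :
    wt ξ l < wt ξ (l - ∑ i ∈ s, g i) ∧ logDiff u v (l - ∑ i ∈ s, g i) = 0 := by
  set c : Expo := ∑ i ∈ s, g i with hc
  have hwc : wt ξ c < 0 := by
    rw [hc, wt_sum]
    exact Finset.sum_neg (fun i hi => wt_neg_of_mem_tailSupport hval (hg i hi)) hs
  have hlt : wt ξ l < wt ξ (l - c) := by rw [wt_tsub ξ hcl]; linarith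
  refine ⟨hlt, ?_⟩
  by_contra hne
  have hmem : l - c ∈ logSupport u v := hne
  have hne' : l - c ≠ l := by
    intro h
    have h' : l - c = l - 0 := by rw [h, tsub_zero]
    have hc0 : c = 0 := eq_of_tsub_eq_tsub hcl (expo_zero_le l) h'
    rw [hc0, wt_zero] at hwc
    exact lt_irrefl _ hwc
  exact lt_irrefl _ ((htop.2 (l - c) hmem hne').trans hlt)

/-! ## The one-letter shadow of a family and the DISJOINTNESS inside a cell -/

/-- Shadow pairs of a family `S`: `(l, a)` with `l ∈ S`, `a` a letter, `a ≤ l`, `a ≠ l`. [folklore] -/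
def shadowPairs (u v : Fin m → MvPolynomial (Fin 2) ℂ) (S : Finset Expo) : Finset (Expo × Expo) :=
  (S ×ˢ tailSupport u v).filter fun p => p.2 ≤ p.1 ∧ p.2 ≠ p.1

/-- The ONE-LETTER SHADOW of `S`: the points `l − a` over the shadow pairs. [folklore] -/
def coShadow (u v : Fin m → MvPolynomial (Fin 2) ℂ) (S : Finset Expo) : Finset Expo :=
  (shadowPairs u v S).image fun p => p.1 - p.2

theorem mem_shadowPairs {u v : Fin m → MvPolynomial (Fin 2) ℂ} {S : Finset Expo} {p : Expo × Expo} :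
    p ∈ shadowPairs u v S ↔ p.1 ∈ S ∧ p.2 ∈ tailSupport u v ∧ p.2 ≤ p.1 ∧ p.2 ≠ p.1 := by
  unfold shadowPairs
  rw [Finset.mem_filter, Finset.mem_product, and_assoc]

theorem mem_coShadow {u v : Fin m → MvPolynomial (Fin 2) ℂ} {S : Finset Expo} {e : Expo} :
    e ∈ coShadow u v S ↔ ∃ l ∈ S, ∃ a ∈ tailSupport u v, a ≤ l ∧ a ≠ l ∧ l - a = e := by
  unfold coShadow
  rw [Finset.mem_image]
  constructor
  · rintro ⟨p, hp, rfl⟩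
    obtain ⟨h1, h2, h3, h4⟩ := mem_shadowPairs.1 hp
    exact ⟨p.1, h1, p.2, h2, h3, h4, rfl⟩
  · rintro ⟨l, hl, a, ha, hal, hne, rfl⟩
    exact ⟨(l, a), mem_shadowPairs.2 ⟨hl, ha, hal, hne⟩, rfl⟩

/-- The shadow grows with the family. [folklore] -/
theorem coShadow_mono (u v : Fin m → MvPolynomial (Fin 2) ℂ) {S T : Finset Expo} (h : S ⊆ T) :
    coShadow u v S ⊆ coShadow u v T := by
  intro e he
  obtain ⟨l, hl, a, ha, hal, hne, rfl⟩ := mem_coShadow.1 he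
  exact mem_coShadow.2 ⟨l, h hl, a, ha, hal, hne, rfl⟩

/-- **Every shadow point of a family of tops is a nonzero KILLED point.** [folklore] -/
theorem coShadow_killed {u v : Fin m → MvPolynomial (Fin 2) ℂ} {S : Finset Expo}
    (hS : ∀ l ∈ S, ∃ ξ : Fin 2 → ℝ, ValidWeight u v ξ ∧ IsStrictTop ξ (logSupport u v) l) :
    ∀ e ∈ coShadow u v S, e ≠ 0 ∧ logDiff u v e = 0 ∧ e ∉ logSupport u v := by
  intro e he
  obtain ⟨l, hl, a, ha, hal, hne, rfl⟩ := mem_coShadow.1 he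
  obtain ⟨ξ, hval, htop⟩ := hS l hl
  have hk := (shadow_kill hval htop ha hal).2
  refine ⟨?_, hk, fun hmem => hmem hk⟩
  intro h0
  exact hne (le_antisymm hal (tsub_eq_zero_iff_le.1 h0))

/-- **THE LEVER — shadows are disjoint inside a cell.** For a weight-order cell family `S`, `l − a = l' − a'` with `l, l' ∈ S` and
letters `a ≤ l`, `a' ≤ l'` forces `l = l'` and `a = a'`. [folklore] -/
theorem eq_of_shadow_eq {u v : Fin m → MvPolynomial (Fin 2) ℂ} {R : Expo → Expo → Prop} {S : Finset Expo}
    (hS : IsCellFamily u v R S) {l l' a a' : Expo} (hl : l ∈ S) (hl' : l' ∈ S) (ha : a ∈ tailSupport u v)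
    (ha' : a' ∈ tailSupport u v) (hal : a ≤ l) (hal' : a' ≤ l') (h : l - a = l' - a') : l = l' ∧ a = a' := by
  obtain ⟨ξ, hval, htop, hR⟩ := hS l hl
  obtain ⟨ξ', hval', htop', hR'⟩ := hS l' hl'
  have e1 : wt ξ l = wt ξ (l - a) + wt ξ a := by rw [wt_tsub ξ hal]; ring
  have e2 : wt ξ l' = wt ξ (l' - a') + wt ξ a' := by rw [wt_tsub ξ hal']; ring
  have e1' : wt ξ' l = wt ξ' (l - a) + wt ξ' a := by rw [wt_tsub ξ' hal]; ring
  have e2' : wt ξ' l' = wt ξ' (l' - a') + wt ξ' a' := by rw [wt_tsub ξ' hal']; ring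
  have hll' : l = l' := by
    by_contra hne
    have h1 : wt ξ l' < wt ξ l := htop.2 l' htop'.1 (Ne.symm hne)
    have h2 : wt ξ' l < wt ξ' l' := htop'.2 l htop.1 hne
    by_cases hRaa' : R a a'
    · have hw : wt ξ a ≤ wt ξ a' := (hR a ha a' ha').1 hRaa'
      rw [h] at e1
      linarith
    · have hw : ¬ (wt ξ' a ≤ wt ξ' a') := fun hh => hRaa' ((hR' a ha a' ha').2 hh)
      push Not at hw
      rw [h] at e1'
      linarith
  subst hll'
  exact ⟨rfl, eq_of_tsub_eq_tsub hal hal' h⟩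

/-- Inside a cell the map `(l, a) ↦ l − a` is injective on the shadow pairs. [folklore] -/
theorem injOn_shadowPairs {u v : Fin m → MvPolynomial (Fin 2) ℂ} {R : Expo → Expo → Prop} {S : Finset Expo}
    (hS : IsCellFamily u v R S) : Set.InjOn (fun p : Expo × Expo => p.1 - p.2) ↑(shadowPairs u v S) := by
  intro p hp q hq hpq
  obtain ⟨hp1, hp2, hp3, -⟩ := mem_shadowPairs.1 (Finset.mem_coe.1 hp)
  obtain ⟨hq1, hq2, hq3, -⟩ := mem_shadowPairs.1 (Finset.mem_coe.1 hq)
  obtain ⟨h1, h2⟩ := eq_of_shadow_eq hS hp1 hq1 hp2 hq2 hp3 hq3 hpq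
  exact Prod.ext h1 h2

/-- **Exact charging inside a cell:** the shadow pairs and the shadow points are equinumerous — every pair `(top, letter below it)`
pays with ITS OWN killed point. [folklore] -/
theorem card_coShadow_eq_card_shadowPairs {u v : Fin m → MvPolynomial (Fin 2) ℂ} {R : Expo → Expo → Prop}
    {S : Finset Expo} (hS : IsCellFamily u v R S) : (coShadow u v S).card = (shadowPairs u v S).card := by
  unfold coShadow
  exact Finset.card_image_of_injOn (injOn_shadowPairs hS)

/-- Tops outside the alphabet have a shadow pair (the letter below them). [folklore] -/
theorem sdiff_subset_image_fst {u v : Fin m → MvPolynomial (Fin 2) ℂ} {S : Finset Expo}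
    (hS : ∀ l ∈ S, l ∈ logSupport u v) :
    S \ tailSupport u v ⊆ (shadowPairs u v S).image Prod.fst := by
  intro l hl
  obtain ⟨hlS, hlL⟩ := Finset.mem_sdiff.1 hl
  obtain ⟨a, ha, hal⟩ := exists_letter_le_of_mem_logSupport (hS l hlS)
  have hne : a ≠ l := by rintro rfl; exact hlL ha
  exact Finset.mem_image.2 ⟨(l, a), mem_shadowPairs.2 ⟨hlS, ha, hal, hne⟩, rfl⟩

theorem card_sdiff_le_card_shadowPairs {u v : Fin m → MvPolynomial (Fin 2) ℂ} {S : Finset Expo}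
    (hS : ∀ l ∈ S, l ∈ logSupport u v) : (S \ tailSupport u v).card ≤ (shadowPairs u v S).card :=
  (Finset.card_le_card (sdiff_subset_image_fst hS)).trans Finset.card_image_le

/-! ## The squeeze theorems -/

/-- **PER-CELL CORNER SQUEEZE.** For a weight-order cell family `S` of log-visible points:
`#S ≤ #(S ∩ letters) + #coShadow S`, every point of `coShadow S` is a nonzero killed point (`D_e = 0`), and the charging is exact
(`#shadowPairs S = #coShadow S`).  This is Conjecture N's shape `V ≤ #letters + k` (val-neg-1 g8) as a theorem per cell, with `k` the number
of killed ONE-LETTER-SHADOW points. [folklore] -/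
theorem cell_corner_squeeze {u v : Fin m → MvPolynomial (Fin 2) ℂ} {R : Expo → Expo → Prop} {S : Finset Expo}
    (hS : IsCellFamily u v R S) :
    S.card ≤ (S ∩ tailSupport u v).card + (coShadow u v S).card ∧
      (shadowPairs u v S).card = (coShadow u v S).card ∧
      ∀ e ∈ coShadow u v S, e ≠ 0 ∧ logDiff u v e = 0 ∧ e ∉ logSupport u v := by
  have hsupp : ∀ l ∈ S, l ∈ logSupport u v := fun l hl => by
    obtain ⟨ξ, -, htop, -⟩ := hS l hl
    exact htop.1
  have htops : ∀ l ∈ S, ∃ ξ : Fin 2 → ℝ, ValidWeight u v ξ ∧ IsStrictTop ξ (logSupport u v) l := fun l hl => by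
    obtain ⟨ξ, hval, htop, -⟩ := hS l hl
    exact ⟨ξ, hval, htop⟩
  refine ⟨?_, (card_coShadow_eq_card_shadowPairs hS).symm, coShadow_killed htops⟩
  calc S.card = (S \ tailSupport u v).card + (S ∩ tailSupport u v).card := (Finset.card_sdiff_add_card_inter S _).symm
    _ ≤ (shadowPairs u v S).card + (S ∩ tailSupport u v).card :=
        Nat.add_le_add_right (card_sdiff_le_card_shadowPairs hsupp) _
    _ = (S ∩ tailSupport u v).card + (coShadow u v S).card := by rw [card_coShadow_eq_card_shadowPairs hS, add_comm]

/-- **Per-cell squeeze, sparse form:** `#S ≤ 2mt + #coShadow S` for `t`-sparse tails. [folklore] -/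
theorem cell_corner_squeeze_sparse {u v : Fin m → MvPolynomial (Fin 2) ℂ} {t : ℕ} (hu : ∀ j, (u j).support.card ≤ t)
    (hv : ∀ j, (v j).support.card ≤ t) {R : Expo → Expo → Prop} {S : Finset Expo} (hS : IsCellFamily u v R S) :
    S.card ≤ 2 * m * t + (coShadow u v S).card :=
  calc S.card ≤ (S ∩ tailSupport u v).card + (coShadow u v S).card := (cell_corner_squeeze hS).1
    _ ≤ (tailSupport u v).card + (coShadow u v S).card :=
        Nat.add_le_add_right (Finset.card_le_card Finset.inter_subset_right) _
    _ ≤ 2 * m * t + (coShadow u v S).card := Nat.add_le_add_right (card_tailSupport_le_two_mul u v t hu hv) _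

/-- Conversely the shadow is never much larger than the family: `#coShadow S ≤ #S · #letters`. [folklore] -/
theorem card_coShadow_le (u v : Fin m → MvPolynomial (Fin 2) ℂ) (S : Finset Expo) :
    (coShadow u v S).card ≤ S.card * (tailSupport u v).card :=
  calc (coShadow u v S).card ≤ (shadowPairs u v S).card := Finset.card_image_le
    _ ≤ (S ×ˢ tailSupport u v).card := Finset.card_le_card (Finset.filter_subset _ _)
    _ = S.card * (tailSupport u v).card := Finset.card_product _ _

/-- **Cell-free squeeze (slope `#letters`).** For ANY finite family of log-visible points,
`#S ≤ #(S ∩ letters) + #letters · #coShadow S` (the pairs inject into `coShadow S × letters` by `(l,a) ↦ (l − a, a)`). [folklore] -/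
theorem logVisible_corner_squeeze {u v : Fin m → MvPolynomial (Fin 2) ℂ} {S : Finset Expo}
    (hS : ∀ l ∈ S, l ∈ logVisible u v) :
    S.card ≤ (S ∩ tailSupport u v).card + (tailSupport u v).card * (coShadow u v S).card ∧
      ∀ e ∈ coShadow u v S, e ≠ 0 ∧ logDiff u v e = 0 ∧ e ∉ logSupport u v := by
  have htops : ∀ l ∈ S, ∃ ξ : Fin 2 → ℝ, ValidWeight u v ξ ∧ IsStrictTop ξ (logSupport u v) l := fun l hl => hS l hl
  have hsupp : ∀ l ∈ S, l ∈ logSupport u v := fun l hl => by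
    obtain ⟨ξ, -, htop⟩ := hS l hl
    exact htop.1
  refine ⟨?_, coShadow_killed htops⟩
  -- the pairs inject into `coShadow S ×ˢ letters`
  have hinj : Set.InjOn (fun p : Expo × Expo => (p.1 - p.2, p.2)) ↑(shadowPairs u v S) := by
    intro p hp q hq hpq
    obtain ⟨-, -, hp3, -⟩ := mem_shadowPairs.1 (Finset.mem_coe.1 hp)
    obtain ⟨-, -, hq3, -⟩ := mem_shadowPairs.1 (Finset.mem_coe.1 hq)
    simp only [Prod.mk.injEq] at hpq
    obtain ⟨h1, h2⟩ := hpq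
    refine Prod.ext ?_ h2
    have hp' : p.1 = p.1 - p.2 + p.2 := (tsub_add_cancel_of_le hp3).symm
    have hq' : q.1 = q.1 - q.2 + q.2 := (tsub_add_cancel_of_le hq3).symm
    rw [hp', hq', h1, h2]
  have hmaps : Set.MapsTo (fun p : Expo × Expo => (p.1 - p.2, p.2)) ↑(shadowPairs u v S)
      ↑(coShadow u v S ×ˢ tailSupport u v) := by
    intro p hp
    obtain ⟨hp1, hp2, hp3, hp4⟩ := mem_shadowPairs.1 (Finset.mem_coe.1 hp)
    exact Finset.mem_coe.2 (Finset.mem_product.2 ⟨mem_coShadow.2 ⟨p.1, hp1, p.2, hp2, hp3, hp4, rfl⟩, hp2⟩)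
  have hpairs : (shadowPairs u v S).card ≤ (coShadow u v S).card * (tailSupport u v).card := by
    rw [← Finset.card_product]
    exact Finset.card_le_card_of_injOn _ hmaps hinj
  calc S.card = (S \ tailSupport u v).card + (S ∩ tailSupport u v).card := (Finset.card_sdiff_add_card_inter S _).symm
    _ ≤ (shadowPairs u v S).card + (S ∩ tailSupport u v).card :=
        Nat.add_le_add_right (card_sdiff_le_card_shadowPairs hsupp) _
    _ ≤ (coShadow u v S).card * (tailSupport u v).card + (S ∩ tailSupport u v).card := Nat.add_le_add_right hpairs _
    _ = (S ∩ tailSupport u v).card + (tailSupport u v).card * (coShadow u v S).card := by ring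

/-! ## Genuine cancellations: shadow points inside the generic log-support -/

/-- GENUINE shadow pairs: shadow pairs `(l, a)` such that `a` is a letter of some factor `w ∈ {u_j, v_j}` and `l − a` is an ACTUAL support point
of a positive power `w ^ r` of the same factor.  Then `l − a` lies in the generic log-support and the vanishing of its log-coefficient is a
cancellation among NONZERO terms (not the trivial zero of a non-representable point). [this file] -/
def genPairs (u v : Fin m → MvPolynomial (Fin 2) ℂ) (S : Finset Expo) : Finset (Expo × Expo) :=
  (shadowPairs u v S).filter fun p => ∃ j : Fin m, ∃ r : ℕ, 1 ≤ r ∧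
    ((p.2 ∈ (u j).support ∧ coeff (p.1 - p.2) (u j ^ r) ≠ 0) ∨ (p.2 ∈ (v j).support ∧ coeff (p.1 - p.2) (v j ^ r) ≠ 0))

/-- The GENUINE one-letter shadow: the points `l − a` over the genuine pairs. [this file] -/
def genShadow (u v : Fin m → MvPolynomial (Fin 2) ℂ) (S : Finset Expo) : Finset Expo :=
  (genPairs u v S).image fun p => p.1 - p.2

theorem genPairs_subset (u v : Fin m → MvPolynomial (Fin 2) ℂ) (S : Finset Expo) : genPairs u v S ⊆ shadowPairs u v S :=
  Finset.filter_subset _ _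

theorem genShadow_subset_coShadow (u v : Fin m → MvPolynomial (Fin 2) ℂ) (S : Finset Expo) :
    genShadow u v S ⊆ coShadow u v S :=
  Finset.image_subset_image (genPairs_subset u v S)

/-- **Every top outside the alphabet has a GENUINE shadow pair:** from `coeff_l (w^r) ≠ 0`, `w^r = w^{r-1}·w`, we get `l = x + a` with
`x ∈ supp (w^{r-1})`, `a ∈ supp w`, and `r − 1 ≥ 1` because `l` is not a letter. [this file] -/
theorem sdiff_subset_image_fst_genPairs {u v : Fin m → MvPolynomial (Fin 2) ℂ} {S : Finset Expo}
    (hS : ∀ l ∈ S, l ∈ logSupport u v) :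
    S \ tailSupport u v ⊆ (genPairs u v S).image Prod.fst := by
  intro l hl
  obtain ⟨hlS, hlL⟩ := Finset.mem_sdiff.1 hl
  -- one factor `w`, a power `r ≥ 1` with `coeff_l (w^r) ≠ 0`, and the side information
  have main : ∀ (w : MvPolynomial (Fin 2) ℂ), w.support ⊆ tailSupport u v → ∀ r : ℕ, 1 ≤ r → coeff l (w ^ r) ≠ 0 →
      ∃ a ∈ w.support, a ≤ l ∧ a ≠ l ∧ ∃ k : ℕ, 1 ≤ k ∧ coeff (l - a) (w ^ k) ≠ 0 := by
    intro w hw r hr hc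
    obtain ⟨k, rfl⟩ : ∃ k, r = k + 1 := ⟨r - 1, by omega⟩
    rw [pow_succ] at hc
    obtain ⟨x, hx, a, ha, hxa⟩ := Finset.mem_add.1 (support_mul _ _ (mem_support_iff.2 hc))
    have hal : a ≤ l := hxa ▸ le_add_self
    have hne : a ≠ l := by rintro rfl; exact hlL (hw ha)
    have hxeq : l - a = x := by rw [← hxa, add_tsub_cancel_right]
    rcases Nat.eq_zero_or_pos k with hk | hk
    · exfalso
      subst hk
      rw [pow_zero, mem_support_iff, coeff_one] at hx
      split_ifs at hx with h0
      · apply hne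
        rw [← hxa, ← h0, zero_add]
      · exact hx rfl
    · exact ⟨a, ha, hal, hne, k, hk, by rw [hxeq]; exact mem_support_iff.1 hx⟩
  obtain ⟨j, ⟨r, hr, hc⟩ | ⟨r, hr, hc⟩⟩ := exists_mem_support_of_mem_logSupport (hS l hlS)
  · obtain ⟨a, ha, hal, hne, k, hk, hck⟩ := main (u j) (fun x hx => mem_tailSupport_of_mem_support_u u v j hx) r hr hc
    refine Finset.mem_image.2 ⟨(l, a), Finset.mem_filter.2 ⟨mem_shadowPairs.2 ⟨hlS, ?_, hal, hne⟩, j, k, hk, Or.inl ⟨ha, hck⟩⟩, rfl⟩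
    exact mem_tailSupport_of_mem_support_u u v j ha
  · obtain ⟨a, ha, hal, hne, k, hk, hck⟩ := main (v j) (fun x hx => mem_tailSupport_of_mem_support_v u v j hx) r hr hc
    refine Finset.mem_image.2 ⟨(l, a), Finset.mem_filter.2 ⟨mem_shadowPairs.2 ⟨hlS, ?_, hal, hne⟩, j, k, hk, Or.inr ⟨ha, hck⟩⟩, rfl⟩
    exact mem_tailSupport_of_mem_support_v u v j ha

/-- **PER-CELL SQUEEZE, GENUINE FORM.**  For a cell family: `#S ≤ #(S ∩ letters) + #genShadow S`, the genuine pairs and genuine shadow points are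
equinumerous (privacy), and every genuine shadow point `e` is a GENUINE CANCELLATION: `D_e = 0` although `e` is an actual support point of a positive
power of one factor (a nonempty fibre with vanishing signed sum). [this file] -/
theorem cell_corner_squeeze_genuine {u v : Fin m → MvPolynomial (Fin 2) ℂ} {R : Expo → Expo → Prop} {S : Finset Expo}
    (hS : IsCellFamily u v R S) :
    S.card ≤ (S ∩ tailSupport u v).card + (genShadow u v S).card ∧
      (genPairs u v S).card = (genShadow u v S).card ∧
      ∀ e ∈ genShadow u v S, e ≠ 0 ∧ logDiff u v e = 0 ∧
        ∃ j : Fin m, ∃ r : ℕ, 1 ≤ r ∧ (coeff e (u j ^ r) ≠ 0 ∨ coeff e (v j ^ r) ≠ 0) := by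
  have hsupp : ∀ l ∈ S, l ∈ logSupport u v := fun l hl => by
    obtain ⟨ξ, -, htop, -⟩ := hS l hl
    exact htop.1
  have htops : ∀ l ∈ S, ∃ ξ : Fin 2 → ℝ, ValidWeight u v ξ ∧ IsStrictTop ξ (logSupport u v) l := fun l hl => by
    obtain ⟨ξ, hval, htop, -⟩ := hS l hl
    exact ⟨ξ, hval, htop⟩
  have hinj : Set.InjOn (fun p : Expo × Expo => p.1 - p.2) ↑(genPairs u v S) :=
    (injOn_shadowPairs hS).mono (Finset.coe_subset.2 (genPairs_subset u v S))
  have hcard : (genShadow u v S).card = (genPairs u v S).card := Finset.card_image_of_injOn hinj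
  refine ⟨?_, hcard.symm, ?_⟩
  · calc S.card = (S \ tailSupport u v).card + (S ∩ tailSupport u v).card := (Finset.card_sdiff_add_card_inter S _).symm
      _ ≤ (genPairs u v S).card + (S ∩ tailSupport u v).card :=
          Nat.add_le_add_right ((Finset.card_le_card (sdiff_subset_image_fst_genPairs hsupp)).trans Finset.card_image_le) _
      _ = (S ∩ tailSupport u v).card + (genShadow u v S).card := by rw [hcard, add_comm]
  · intro e he
    obtain ⟨h0, hk, -⟩ := coShadow_killed htops e (genShadow_subset_coShadow u v S he)
    obtain ⟨p, hp, rfl⟩ := Finset.mem_image.1 he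
    obtain ⟨-, j, r, hr, ⟨-, hc⟩ | ⟨-, hc⟩⟩ := Finset.mem_filter.1 hp
    · exact ⟨h0, hk, j, r, hr, Or.inl hc⟩
    · exact ⟨h0, hk, j, r, hr, Or.inr hc⟩

/-! ## Shallow tops are few: the privacy gain at depth two -/

/-- SHALLOW members of `S`: those with a LETTER among their one-letter shadow points (e.g. every top that is a sum of two letters). -/
def shallow (u v : Fin m → MvPolynomial (Fin 2) ℂ) (S : Finset Expo) : Finset Expo :=
  S.filter fun l => ∃ a ∈ tailSupport u v, a ≤ l ∧ a ≠ l ∧ l - a ∈ tailSupport u v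

theorem shallow_subset (u v : Fin m → MvPolynomial (Fin 2) ℂ) (S : Finset Expo) : shallow u v S ⊆ S :=
  Finset.filter_subset _ _

/-- **Shallow tops inject into the KILLED LETTERS of the shadow** (privacy): in a cell, `#shallow S ≤ #(coShadow S ∩ letters)`. [this file] -/
theorem card_shallow_le {u v : Fin m → MvPolynomial (Fin 2) ℂ} {R : Expo → Expo → Prop} {S : Finset Expo}
    (hS : IsCellFamily u v R S) : (shallow u v S).card ≤ (coShadow u v S ∩ tailSupport u v).card := by
  have key : ∀ l ∈ shallow u v S, ∃ a ∈ tailSupport u v, a ≤ l ∧ a ≠ l ∧ l - a ∈ tailSupport u v :=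
    fun l hl => (Finset.mem_filter.1 hl).2
  choose! f hf using key
  refine Finset.card_le_card_of_injOn (fun l => l - f l) (fun l hl => ?_) ?_
  · have hl' : l ∈ shallow u v S := Finset.mem_coe.1 hl
    obtain ⟨hfL, hfle, hfne, hdiff⟩ := hf l hl'
    have hlS : l ∈ S := (Finset.mem_filter.1 hl').1
    exact Finset.mem_coe.2 (Finset.mem_inter.2 ⟨mem_coShadow.2 ⟨l, hlS, f l, hfL, hfle, hfne, rfl⟩, hdiff⟩)
  · intro l hl l' hl' h
    have hlm : l ∈ shallow u v S := Finset.mem_coe.1 hl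
    have hlm' : l' ∈ shallow u v S := Finset.mem_coe.1 hl'
    obtain ⟨hfL, hfle, -, -⟩ := hf l hlm
    obtain ⟨hfL', hfle', -, -⟩ := hf l' hlm'
    exact (eq_of_shadow_eq hS (Finset.mem_filter.1 hlm).1 (Finset.mem_filter.1 hlm').1 hfL hfL' hfle hfle' h).1

/-- A member of a cell family that is a sum of two letters is shallow. [this file] -/
theorem mem_shallow_of_eq_add {u v : Fin m → MvPolynomial (Fin 2) ℂ} {R : Expo → Expo → Prop} {S : Finset Expo}
    (hS : IsCellFamily u v R S) {l a a' : Expo} (hl : l ∈ S) (ha : a ∈ tailSupport u v)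
    (ha' : a' ∈ tailSupport u v) (h : l = a + a') : l ∈ shallow u v S := by
  obtain ⟨ξ, hval, -, -⟩ := hS l hl
  refine Finset.mem_filter.2 ⟨hl, a, ha, ?_, ?_, ?_⟩
  · rw [h]; exact le_self_add
  · intro hal
    apply ne_zero_of_mem_tailSupport hval ha'
    have : a + a' = a + 0 := by rw [← h, ← hal, add_zero]
    exact add_left_cancel this
  · have : l - a = a' := by rw [h, add_tsub_cancel_left]
    rw [this]; exact ha'

/-- **The privacy gain at depth two.** In one cell, the visible points that are LETTERS or SUMS OF TWO LETTERS number at most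
`#letters + #(killed letters in the shadow) ≤ 2 · #letters ≤ 4mt` — linear, against the quadratic size of `letters + letters`.
(All other members of `S` are DEEP: every one-letter shadow point of theirs is a killed NON-letter.) [this file] -/
theorem card_le_two_sums {u v : Fin m → MvPolynomial (Fin 2) ℂ} {R : Expo → Expo → Prop} {S : Finset Expo}
    (hS : IsCellFamily u v R S) :
    (S.filter fun l => l ∈ tailSupport u v ∨ ∃ a ∈ tailSupport u v, ∃ a' ∈ tailSupport u v, l = a + a').card ≤
      (tailSupport u v).card + (coShadow u v S ∩ tailSupport u v).card := by
  have hsub : (S.filter fun l => l ∈ tailSupport u v ∨ ∃ a ∈ tailSupport u v, ∃ a' ∈ tailSupport u v, l = a + a') ⊆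
      (S ∩ tailSupport u v) ∪ shallow u v S := by
    intro l hl
    obtain ⟨hlS, hL | ⟨a, ha, a', ha', h⟩⟩ := Finset.mem_filter.1 hl
    · exact Finset.mem_union.2 (Or.inl (Finset.mem_inter.2 ⟨hlS, hL⟩))
    · exact Finset.mem_union.2 (Or.inr (mem_shallow_of_eq_add hS hlS ha ha' h))
  calc _ ≤ ((S ∩ tailSupport u v) ∪ shallow u v S).card := Finset.card_le_card hsub
    _ ≤ (S ∩ tailSupport u v).card + (shallow u v S).card := Finset.card_union_le _ _
    _ ≤ (tailSupport u v).card + (coShadow u v S ∩ tailSupport u v).card :=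
        add_le_add (Finset.card_le_card Finset.inter_subset_right) (card_shallow_le hS)

/-- The deep/shallow split of a cell family: `#S ≤ #(S ∩ letters) + #(coShadow S ∩ letters) + #(S \ letters \ shallow S)`. [this file] -/
theorem card_le_shallow_add_deep {u v : Fin m → MvPolynomial (Fin 2) ℂ} {R : Expo → Expo → Prop} {S : Finset Expo}
    (hS : IsCellFamily u v R S) :
    S.card ≤ (S ∩ tailSupport u v).card + (coShadow u v S ∩ tailSupport u v).card +
      ((S \ tailSupport u v) \ shallow u v S).card := by
  have hsub : S ⊆ (S ∩ tailSupport u v) ∪ shallow u v S ∪ ((S \ tailSupport u v) \ shallow u v S) := by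
    intro l hl
    by_cases h1 : l ∈ tailSupport u v
    · exact Finset.mem_union.2 (Or.inl (Finset.mem_union.2 (Or.inl (Finset.mem_inter.2 ⟨hl, h1⟩))))
    · by_cases h2 : l ∈ shallow u v S
      · exact Finset.mem_union.2 (Or.inl (Finset.mem_union.2 (Or.inr h2)))
      · exact Finset.mem_union.2 (Or.inr (Finset.mem_sdiff.2 ⟨Finset.mem_sdiff.2 ⟨hl, h1⟩, h2⟩))
  calc S.card ≤ ((S ∩ tailSupport u v) ∪ shallow u v S ∪ ((S \ tailSupport u v) \ shallow u v S)).card :=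
        Finset.card_le_card hsub
    _ ≤ ((S ∩ tailSupport u v) ∪ shallow u v S).card + ((S \ tailSupport u v) \ shallow u v S).card :=
        Finset.card_union_le _ _
    _ ≤ (S ∩ tailSupport u v).card + (shallow u v S).card + ((S \ tailSupport u v) \ shallow u v S).card :=
        Nat.add_le_add_right (Finset.card_union_le _ _) _
    _ ≤ (S ∩ tailSupport u v).card + (coShadow u v S ∩ tailSupport u v).card +
          ((S \ tailSupport u v) \ shallow u v S).card :=
        Nat.add_le_add_right (Nat.add_le_add_left (card_shallow_le hS) _) _

/-! ## No parallelograms among valid tops: the GLOBAL squeeze (slope 1, quadratic intercept) -/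

private theorem bil_sub (p q x y x' y' : ℝ) : p * (x' - x) + q * (y' - y) = (p * x' + q * y') - (p * x + q * y) := by ring

/-- Pure sign lemma in `ℝ²`.  Four functionals `(pᵢ, qᵢ)`; points `w₁, w₂, w₃` with real coordinates and `w₄ := w₂ + w₃ − w₁`; functional `i`
strictly prefers `wᵢ` to the two "adjacent" points; and all four are negative on a common vector `(a₀, a₁)`.  Impossible: the four functionals
would have the four sign patterns `(−,−),(+,−),(−,+),(+,+)` on `(w₂ − w₁, w₃ − w₁)`, which no open half-plane of functionals accommodates. [folklore] -/
theorem four_tops_false {p₁ q₁ p₂ q₂ p₃ q₃ p₄ q₄ x₁ y₁ x₂ y₂ x₃ y₃ x₄ y₄ a₀ a₁ : ℝ}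
    (hx : x₁ + x₄ = x₂ + x₃) (hy : y₁ + y₄ = y₂ + y₃)
    (i12 : p₁ * x₂ + q₁ * y₂ < p₁ * x₁ + q₁ * y₁) (i13 : p₁ * x₃ + q₁ * y₃ < p₁ * x₁ + q₁ * y₁)
    (i21 : p₂ * x₁ + q₂ * y₁ < p₂ * x₂ + q₂ * y₂) (i24 : p₂ * x₄ + q₂ * y₄ < p₂ * x₂ + q₂ * y₂)
    (i31 : p₃ * x₁ + q₃ * y₁ < p₃ * x₃ + q₃ * y₃) (i34 : p₃ * x₄ + q₃ * y₄ < p₃ * x₃ + q₃ * y₃)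
    (i42 : p₄ * x₂ + q₄ * y₂ < p₄ * x₄ + q₄ * y₄) (i43 : p₄ * x₃ + q₄ * y₃ < p₄ * x₄ + q₄ * y₄)
    (hA1 : p₁ * a₀ + q₁ * a₁ < 0) (hA2 : p₂ * a₀ + q₂ * a₁ < 0) (hA3 : p₃ * a₀ + q₃ * a₁ < 0)
    (hA4 : p₄ * a₀ + q₄ * a₁ < 0) : False := by
  have hx4 : x₄ = x₂ + x₃ - x₁ := by linarith
  have hy4 : y₄ = y₂ + y₃ - y₁ := by linarith
  subst hx4 hy4
  -- the eight signs on d := w₂ − w₁ and c := w₃ − w₁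
  have h1D : p₁ * (x₂ - x₁) + q₁ * (y₂ - y₁) < 0 := by rw [bil_sub]; linarith
  have h1C : p₁ * (x₃ - x₁) + q₁ * (y₃ - y₁) < 0 := by rw [bil_sub]; linarith
  have h2D : 0 < p₂ * (x₂ - x₁) + q₂ * (y₂ - y₁) := by rw [bil_sub]; linarith
  have h2C : p₂ * (x₃ - x₁) + q₂ * (y₃ - y₁) < 0 := by
    have e : p₂ * (x₃ - x₁) + q₂ * (y₃ - y₁) = (p₂ * (x₂ + x₃ - x₁) + q₂ * (y₂ + y₃ - y₁)) - (p₂ * x₂ + q₂ * y₂) := by ring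
    rw [e]; linarith
  have h3C : 0 < p₃ * (x₃ - x₁) + q₃ * (y₃ - y₁) := by rw [bil_sub]; linarith
  have h3D : p₃ * (x₂ - x₁) + q₃ * (y₂ - y₁) < 0 := by
    have e : p₃ * (x₂ - x₁) + q₃ * (y₂ - y₁) = (p₃ * (x₂ + x₃ - x₁) + q₃ * (y₂ + y₃ - y₁)) - (p₃ * x₃ + q₃ * y₃) := by ring
    rw [e]; linarith
  have h4D : 0 < p₄ * (x₂ - x₁) + q₄ * (y₂ - y₁) := by
    have e : p₄ * (x₂ - x₁) + q₄ * (y₂ - y₁) = (p₄ * (x₂ + x₃ - x₁) + q₄ * (y₂ + y₃ - y₁)) - (p₄ * x₃ + q₄ * y₃) := by ring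
    rw [e]; linarith
  have h4C : 0 < p₄ * (x₃ - x₁) + q₄ * (y₃ - y₁) := by
    have e : p₄ * (x₃ - x₁) + q₄ * (y₃ - y₁) = (p₄ * (x₂ + x₃ - x₁) + q₄ * (y₂ + y₃ - y₁)) - (p₄ * x₂ + q₄ * y₂) := by ring
    rw [e]; linarith
  -- abbreviate
  generalize hd0 : x₂ - x₁ = d₀ at h1D h2D h3D h4D
  generalize hd1 : y₂ - y₁ = d₁ at h1D h2D h3D h4D
  generalize hc0 : x₃ - x₁ = c₀ at h1C h2C h3C h4C
  generalize hc1 : y₃ - y₁ = c₁ at h1C h2C h3C h4C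
  clear i12 i13 i21 i24 i31 i34 i42 i43 hd0 hd1 hc0 hc1 hx hy
  -- the sign chase: no `(α, β)` makes `α·Dᵢ + β·Cᵢ > 0` for all four `i`
  have chase : ∀ α β : ℝ,
      0 < α * (p₁ * d₀ + q₁ * d₁) + β * (p₁ * c₀ + q₁ * c₁) → 0 < α * (p₂ * d₀ + q₂ * d₁) + β * (p₂ * c₀ + q₂ * c₁) →
      0 < α * (p₃ * d₀ + q₃ * d₁) + β * (p₃ * c₀ + q₃ * c₁) → 0 < α * (p₄ * d₀ + q₄ * d₁) + β * (p₄ * c₀ + q₄ * c₁) → False := by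
    intro α β g1 g2 g3 g4
    rcases lt_trichotomy α 0 with hα | hα | hα
    · have hβ : 0 < β := by
        by_contra hβ'
        have hβ : β ≤ 0 := not_lt.1 hβ'
        have t1 : α * (p₄ * d₀ + q₄ * d₁) < 0 := mul_neg_of_neg_of_pos hα h4D
        have t2 : β * (p₄ * c₀ + q₄ * c₁) ≤ 0 := by nlinarith
        linarith
      have t1 : α * (p₂ * d₀ + q₂ * d₁) < 0 := mul_neg_of_neg_of_pos hα h2D
      have t2 : β * (p₂ * c₀ + q₂ * c₁) < 0 := mul_neg_of_pos_of_neg hβ h2C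
      linarith
    · subst hα
      have t1 : 0 < β * (p₁ * c₀ + q₁ * c₁) := by linarith
      have t4 : 0 < β * (p₄ * c₀ + q₄ * c₁) := by linarith
      nlinarith
    · have hβ : β < 0 := by
        by_contra hβ'
        have hβ : 0 ≤ β := not_lt.1 hβ'
        have t1 : α * (p₁ * d₀ + q₁ * d₁) < 0 := mul_neg_of_pos_of_neg hα h1D
        have t2 : β * (p₁ * c₀ + q₁ * c₁) ≤ 0 := by nlinarith
        linarith
      have t1 : α * (p₃ * d₀ + q₃ * d₁) < 0 := mul_neg_of_pos_of_neg hα h3D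
      have t2 : β * (p₃ * c₀ + q₃ * c₁) < 0 := mul_neg_of_neg_of_pos hβ h3C
      linarith
  -- Cramer: `det · a = α' d + β' c`
  have key : ∀ p q : ℝ, (d₀ * c₁ - d₁ * c₀) * (p * a₀ + q * a₁) =
      (a₀ * c₁ - a₁ * c₀) * (p * d₀ + q * d₁) + (d₀ * a₁ - d₁ * a₀) * (p * c₀ + q * c₁) := by
    intro p q; ring
  rcases lt_trichotomy (d₀ * c₁ - d₁ * c₀) 0 with hd | hd | hd
  · refine chase (a₀ * c₁ - a₁ * c₀) (d₀ * a₁ - d₁ * a₀) ?_ ?_ ?_ ?_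
    · rw [← key]; exact mul_pos_of_neg_of_neg hd hA1
    · rw [← key]; exact mul_pos_of_neg_of_neg hd hA2
    · rw [← key]; exact mul_pos_of_neg_of_neg hd hA3
    · rw [← key]; exact mul_pos_of_neg_of_neg hd hA4
  · -- degenerate: `d ∥ c`, but functional 1 is negative on both while functional 2 separates them
    have r0 : ∀ p q : ℝ, c₀ * (p * d₀ + q * d₁) = d₀ * (p * c₀ + q * c₁) := by
      intro p q
      have e : c₀ * (p * d₀ + q * d₁) - d₀ * (p * c₀ + q * c₁) = -(q * (d₀ * c₁ - d₁ * c₀)) := by ring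
      rw [hd] at e; linarith
    have r1 : ∀ p q : ℝ, c₁ * (p * d₀ + q * d₁) = d₁ * (p * c₀ + q * c₁) := by
      intro p q
      have e : c₁ * (p * d₀ + q * d₁) - d₁ * (p * c₀ + q * c₁) = p * (d₀ * c₁ - d₁ * c₀) := by ring
      rw [hd] at e; linarith
    have hDD : (p₁ * d₀ + q₁ * d₁) * (p₂ * d₀ + q₂ * d₁) < 0 := mul_neg_of_neg_of_pos h1D h2D
    have hCC : 0 < (p₁ * c₀ + q₁ * c₁) * (p₂ * c₀ + q₂ * c₁) := mul_pos_of_neg_of_neg h1C h2C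
    by_cases hc0 : c₀ = 0
    · by_cases hc1 : c₁ = 0
      · subst hc0 hc1
        simp only [mul_zero, add_zero] at h1C
        exact lt_irrefl _ h1C
      · have e : c₁ ^ 2 * ((p₁ * d₀ + q₁ * d₁) * (p₂ * d₀ + q₂ * d₁)) = d₁ ^ 2 * ((p₁ * c₀ + q₁ * c₁) * (p₂ * c₀ + q₂ * c₁)) := by
          calc c₁ ^ 2 * ((p₁ * d₀ + q₁ * d₁) * (p₂ * d₀ + q₂ * d₁))
              = (c₁ * (p₁ * d₀ + q₁ * d₁)) * (c₁ * (p₂ * d₀ + q₂ * d₁)) := by ring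
            _ = (d₁ * (p₁ * c₀ + q₁ * c₁)) * (d₁ * (p₂ * c₀ + q₂ * c₁)) := by rw [r1, r1]
            _ = d₁ ^ 2 * ((p₁ * c₀ + q₁ * c₁) * (p₂ * c₀ + q₂ * c₁)) := by ring
        have hsq : 0 < c₁ ^ 2 := lt_of_le_of_ne (sq_nonneg c₁) (Ne.symm (pow_ne_zero 2 hc1))
        have hL : c₁ ^ 2 * ((p₁ * d₀ + q₁ * d₁) * (p₂ * d₀ + q₂ * d₁)) < 0 := mul_neg_of_pos_of_neg hsq hDD
        have hR : 0 ≤ d₁ ^ 2 * ((p₁ * c₀ + q₁ * c₁) * (p₂ * c₀ + q₂ * c₁)) := mul_nonneg (sq_nonneg _) hCC.le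
        linarith
    · have e : c₀ ^ 2 * ((p₁ * d₀ + q₁ * d₁) * (p₂ * d₀ + q₂ * d₁)) = d₀ ^ 2 * ((p₁ * c₀ + q₁ * c₁) * (p₂ * c₀ + q₂ * c₁)) := by
        calc c₀ ^ 2 * ((p₁ * d₀ + q₁ * d₁) * (p₂ * d₀ + q₂ * d₁))
            = (c₀ * (p₁ * d₀ + q₁ * d₁)) * (c₀ * (p₂ * d₀ + q₂ * d₁)) := by ring
          _ = (d₀ * (p₁ * c₀ + q₁ * c₁)) * (d₀ * (p₂ * c₀ + q₂ * c₁)) := by rw [r0, r0]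
          _ = d₀ ^ 2 * ((p₁ * c₀ + q₁ * c₁) * (p₂ * c₀ + q₂ * c₁)) := by ring
      have hsq : 0 < c₀ ^ 2 := lt_of_le_of_ne (sq_nonneg c₀) (Ne.symm (pow_ne_zero 2 hc0))
      have hL : c₀ ^ 2 * ((p₁ * d₀ + q₁ * d₁) * (p₂ * d₀ + q₂ * d₁)) < 0 := mul_neg_of_pos_of_neg hsq hDD
      have hR : 0 ≤ d₀ ^ 2 * ((p₁ * c₀ + q₁ * c₁) * (p₂ * c₀ + q₂ * c₁)) := mul_nonneg (sq_nonneg _) hCC.le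
      linarith
  · refine chase (-(a₀ * c₁ - a₁ * c₀)) (-(d₀ * a₁ - d₁ * a₀)) ?_ ?_ ?_ ?_
    · have t := mul_neg_of_pos_of_neg hd hA1; rw [key] at t; linarith
    · have t := mul_neg_of_pos_of_neg hd hA2; rw [key] at t; linarith
    · have t := mul_neg_of_pos_of_neg hd hA3; rw [key] at t; linarith
    · have t := mul_neg_of_pos_of_neg hd hA4; rw [key] at t; linarith

/-- **NO PARALLELOGRAMS AMONG VALID TOPS.**  If `w₁, w₂, w₃, w₄` are strict tops of one set `T` for weights `ξ₁,…,ξ₄` that are all negative on a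
common point `a`, and `w₁ + w₄ = w₂ + w₃` with `w₁ ≠ w₂`, then `w₁ = w₃` (and so `w₂ = w₄`): a difference vector is realised by at most ONE ordered
pair of valid tops (they lie on a graph-like strictly convex chain). [this file] -/
theorem eq_of_add_eq_add_of_tops {T : Set Expo} {ξ₁ ξ₂ ξ₃ ξ₄ : Fin 2 → ℝ} {w₁ w₂ w₃ w₄ a : Expo}
    (ha₁ : wt ξ₁ a < 0) (ha₂ : wt ξ₂ a < 0) (ha₃ : wt ξ₃ a < 0) (ha₄ : wt ξ₄ a < 0)
    (h₁ : IsStrictTop ξ₁ T w₁) (h₂ : IsStrictTop ξ₂ T w₂) (h₃ : IsStrictTop ξ₃ T w₃) (h₄ : IsStrictTop ξ₄ T w₄)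
    (hsum : w₁ + w₄ = w₂ + w₃) (h₁₂ : w₁ ≠ w₂) : w₁ = w₃ := by
  by_contra h₁₃
  have h₂₄ : w₂ ≠ w₄ := by
    intro h; apply h₁₃; rw [h] at hsum; exact add_right_cancel (hsum.trans (add_comm _ _))
  have h₃₄ : w₃ ≠ w₄ := by
    intro h; apply h₁₂; rw [h] at hsum; exact add_right_cancel hsum
  have i12 := h₁.2 w₂ h₂.1 h₁₂.symm
  have i13 := h₁.2 w₃ h₃.1 (Ne.symm h₁₃)
  have i21 := h₂.2 w₁ h₁.1 h₁₂
  have i24 := h₂.2 w₄ h₄.1 h₂₄.symm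
  have i31 := h₃.2 w₁ h₁.1 h₁₃
  have i34 := h₃.2 w₄ h₄.1 h₃₄.symm
  have i42 := h₄.2 w₂ h₂.1 h₂₄
  have i43 := h₄.2 w₃ h₃.1 h₃₄
  have hx : ((w₁ 0 : ℕ) : ℝ) + ((w₄ 0 : ℕ) : ℝ) = ((w₂ 0 : ℕ) : ℝ) + ((w₃ 0 : ℕ) : ℝ) := by
    have h := DFunLike.congr_fun hsum 0
    simp only [Finsupp.add_apply] at h
    exact_mod_cast h
  have hy : ((w₁ 1 : ℕ) : ℝ) + ((w₄ 1 : ℕ) : ℝ) = ((w₂ 1 : ℕ) : ℝ) + ((w₃ 1 : ℕ) : ℝ) := by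
    have h := DFunLike.congr_fun hsum 1
    simp only [Finsupp.add_apply] at h
    exact_mod_cast h
  unfold wt at i12 i13 i21 i24 i31 i34 i42 i43 ha₁ ha₂ ha₃ ha₄
  exact four_tops_false hx hy i12 i13 i21 i24 i31 i34 i42 i43 ha₁ ha₂ ha₃ ha₄

/-- COLLISIONS: ordered pairs of DISTINCT pairs `(l, a) ≠ (l', a')` of `P` with the same shadow point `l − a = l' − a'`. -/
def collisions (P : Finset (Expo × Expo)) : Finset ((Expo × Expo) × (Expo × Expo)) :=
  (P ×ˢ P).filter fun pp => pp.1.1 - pp.1.2 = pp.2.1 - pp.2.2 ∧ pp.1 ≠ pp.2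

/-- Fibre counting: `#P ≤ #(shadow image of P) + #collisions P` (a fibre of size `n` contributes `n ≤ 1 + n(n−1)` — indeed `≤ 1 + (n−1)`). [folklore] -/
theorem card_le_card_image_add_card_collisions (P : Finset (Expo × Expo)) :
    P.card ≤ (P.image fun p => p.1 - p.2).card + (collisions P).card := by
  have hP := Finset.card_eq_sum_card_image (fun p : Expo × Expo => p.1 - p.2) P
  have hQ : (collisions P).card = ∑ e ∈ P.image (fun p => p.1 - p.2),
      ((collisions P).filter fun pp => pp.1.1 - pp.1.2 = e).card :=
    Finset.card_eq_sum_card_fiberwise (f := fun pp : (Expo × Expo) × (Expo × Expo) => pp.1.1 - pp.1.2)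
      (fun pp hpp => by
        have h := (Finset.mem_filter.1 (Finset.mem_coe.1 hpp)).1
        exact Finset.mem_coe.2 (Finset.mem_image_of_mem _ (Finset.mem_product.1 h).1))
  have hfib : ∀ e ∈ P.image (fun p => p.1 - p.2),
      (P.filter fun p => p.1 - p.2 = e).card ≤ 1 + ((collisions P).filter fun pp => pp.1.1 - pp.1.2 = e).card := by
    intro e he
    obtain ⟨p₀, hp₀, hp₀e⟩ := Finset.mem_image.1 he
    have hp₀f : p₀ ∈ P.filter (fun p => p.1 - p.2 = e) := Finset.mem_filter.2 ⟨hp₀, hp₀e⟩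
    have hcard := Finset.card_erase_add_one hp₀f
    have hinj : ((P.filter fun p => p.1 - p.2 = e).erase p₀).card ≤
        ((collisions P).filter fun pp => pp.1.1 - pp.1.2 = e).card := by
      refine Finset.card_le_card_of_injOn (fun p => (p₀, p)) (fun p hp => ?_) ?_
      · obtain ⟨hne, hpf⟩ := Finset.mem_erase.1 (Finset.mem_coe.1 hp)
        obtain ⟨hpP, hpe⟩ := Finset.mem_filter.1 hpf
        refine Finset.mem_coe.2 (Finset.mem_filter.2
          ⟨Finset.mem_filter.2 ⟨Finset.mem_product.2 ⟨hp₀, hpP⟩, ?_, fun h => hne h.symm⟩, hp₀e⟩)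
        show p₀.1 - p₀.2 = p.1 - p.2
        rw [hp₀e, hpe]
      · intro p _ p' _ h
        exact (Prod.ext_iff.1 h).2
    omega
  have hsum := Finset.sum_le_sum hfib
  rw [Finset.sum_add_distrib, Finset.sum_const, smul_eq_mul, mul_one] at hsum
  omega

/-- **Collisions inject into ordered pairs of distinct letters** (no parallelograms): for pairs drawn from the shadow pairs of a family of
log-visible points, `#collisions P ≤ #letters · (#letters − 1)`. [this file] -/
theorem card_collisions_le {u v : Fin m → MvPolynomial (Fin 2) ℂ} {S : Finset Expo} {P : Finset (Expo × Expo)}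
    (hS : ∀ l ∈ S, l ∈ logVisible u v) (hP : P ⊆ shadowPairs u v S) :
    (collisions P).card ≤ (tailSupport u v).offDiag.card := by
  refine Finset.card_le_card_of_injOn (fun pp => (pp.1.2, pp.2.2)) (fun pp hpp => ?_) ?_
  · obtain ⟨hprod, heq, hne⟩ := Finset.mem_filter.1 (Finset.mem_coe.1 hpp)
    obtain ⟨h1, h2⟩ := Finset.mem_product.1 hprod
    obtain ⟨-, ha1, hle1, -⟩ := mem_shadowPairs.1 (hP h1)
    obtain ⟨-, ha2, hle2, -⟩ := mem_shadowPairs.1 (hP h2)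
    refine Finset.mem_coe.2 (Finset.mem_offDiag.2 ⟨ha1, ha2, fun haa => hne ?_⟩)
    have h11 : pp.1.1 = pp.2.1 := by
      rw [← tsub_add_cancel_of_le hle1, heq, show pp.1.2 = pp.2.2 from haa, tsub_add_cancel_of_le hle2]
    exact Prod.ext h11 haa
  · rintro ⟨⟨l₁, a⟩, ⟨l₂, b⟩⟩ hpp ⟨⟨l₁', a'⟩, ⟨l₂', b'⟩⟩ hpp' h
    simp only [Prod.mk.injEq] at h
    obtain ⟨rfl, rfl⟩ := h
    obtain ⟨hprod, heq, hne⟩ := Finset.mem_filter.1 (Finset.mem_coe.1 hpp)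
    obtain ⟨hprod', heq', hne'⟩ := Finset.mem_filter.1 (Finset.mem_coe.1 hpp')
    simp only at heq heq' hne hne'
    obtain ⟨h1, h2⟩ := Finset.mem_product.1 hprod
    obtain ⟨h1', h2'⟩ := Finset.mem_product.1 hprod'
    obtain ⟨hl1, ha, hle1, -⟩ := mem_shadowPairs.1 (hP h1)
    obtain ⟨hl2, hb, hle2, -⟩ := mem_shadowPairs.1 (hP h2)
    obtain ⟨hl1', -, hle1', -⟩ := mem_shadowPairs.1 (hP h1')
    obtain ⟨hl2', -, hle2', -⟩ := mem_shadowPairs.1 (hP h2')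
    simp only at hl1 hl2 hl1' hl2' ha hb hle1 hle2 hle1' hle2'
    -- the parallelogram `l₁ + l₂' = l₂ + l₁'`
    have hsum : l₁ + l₂' = l₂ + l₁' := by
      calc l₁ + l₂' = (l₁ - a + a) + (l₂' - b + b) := by rw [tsub_add_cancel_of_le hle1, tsub_add_cancel_of_le hle2']
        _ = (l₂ - b + a) + (l₁' - a + b) := by rw [heq, ← heq']
        _ = (l₂ - b + b) + (l₁' - a + a) := by rw [add_add_add_comm, add_comm a b, ← add_add_add_comm]
        _ = l₂ + l₁' := by rw [tsub_add_cancel_of_le hle2, tsub_add_cancel_of_le hle1']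
    have h12 : l₁ ≠ l₂ := by
      intro h
      apply hne
      have hab : a = b := by
        have e1 : l₁ - a + a = l₁ - a + b := by
          rw [tsub_add_cancel_of_le hle1, heq, tsub_add_cancel_of_le hle2, h]
        exact add_left_cancel e1
      rw [h, hab]
    obtain ⟨ξ₁, hv₁, ht₁⟩ := hS l₁ hl1
    obtain ⟨ξ₂, hv₂, ht₂⟩ := hS l₂ hl2
    obtain ⟨ξ₃, hv₃, ht₃⟩ := hS l₁' hl1'
    obtain ⟨ξ₄, hv₄, ht₄⟩ := hS l₂' hl2'
    have key : l₁ = l₁' :=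
      eq_of_add_eq_add_of_tops (wt_neg_of_mem_tailSupport hv₁ ha) (wt_neg_of_mem_tailSupport hv₂ ha)
        (wt_neg_of_mem_tailSupport hv₃ ha) (wt_neg_of_mem_tailSupport hv₄ ha) ht₁ ht₂ ht₃ ht₄ hsum h12
    subst key
    have key2 : l₂ = l₂' := by
      rw [← tsub_add_cancel_of_le hle2, ← heq, heq', tsub_add_cancel_of_le hle2']
    subst key2
    rfl

/-- **THE GLOBAL CORNER SQUEEZE (slope 1).**  For ANY finite family `S` of log-visible points:
`#S ≤ #(S ∩ letters) + #genShadow S + #letters·(#letters − 1)` — every visible point beyond the first `#letters + #letters(#letters−1)` is paid for by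
its OWN genuine cancellation one letter below the hull.  (Privacy fails across cells only through parallelograms of tops, and valid tops admit none.)
[this file] -/
theorem global_corner_squeeze {u v : Fin m → MvPolynomial (Fin 2) ℂ} {S : Finset Expo} (hS : ∀ l ∈ S, l ∈ logVisible u v) :
    S.card ≤ (S ∩ tailSupport u v).card + (genShadow u v S).card + (tailSupport u v).offDiag.card := by
  have hsupp : ∀ l ∈ S, l ∈ logSupport u v := fun l hl => by
    obtain ⟨ξ, -, ht⟩ := hS l hl
    exact ht.1
  have h1 : (S \ tailSupport u v).card ≤ (genPairs u v S).card :=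
    (Finset.card_le_card (sdiff_subset_image_fst_genPairs hsupp)).trans Finset.card_image_le
  have h2 : (genPairs u v S).card ≤ (genShadow u v S).card + (collisions (genPairs u v S)).card :=
    card_le_card_image_add_card_collisions _
  have h3 : (collisions (genPairs u v S)).card ≤ (tailSupport u v).offDiag.card :=
    card_collisions_le hS (genPairs_subset u v S)
  have h4 := Finset.card_sdiff_add_card_inter S (tailSupport u v)
  omega

/-- **Global squeeze, sparse form:** `#S ≤ 2mt + (2mt)² + #genShadow S` for any family of log-visible points with `t`-sparse tails. [this file] -/
theorem global_corner_squeeze_sparse {u v : Fin m → MvPolynomial (Fin 2) ℂ} {t : ℕ} (hu : ∀ j, (u j).support.card ≤ t)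
    (hv : ∀ j, (v j).support.card ≤ t) {S : Finset Expo} (hS : ∀ l ∈ S, l ∈ logVisible u v) :
    S.card ≤ 2 * m * t + (2 * m * t) * (2 * m * t) + (genShadow u v S).card := by
  have h := global_corner_squeeze hS
  have hL := card_tailSupport_le_two_mul u v t hu hv
  have h1 : (S ∩ tailSupport u v).card ≤ 2 * m * t := (Finset.card_le_card Finset.inter_subset_right).trans hL
  have h2 : (tailSupport u v).offDiag.card ≤ (2 * m * t) * (2 * m * t) := by
    rw [Finset.offDiag_card]
    exact (Nat.sub_le _ _).trans (Nat.mul_le_mul hL hL)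
  omega

/-! ## The target of the line of record in MASS-CANCELLATION currency -/

/-- VERBATIM `PlanarCellBound` (the hypothesis of the landed `twoProducts_of_planarCellBound`, p596451; = `Lines/planar_cell.lean` l.456). -/
def PlanarCellBound : Prop :=
  ∃ a b : ℕ, ∀ (m t : ℕ), 2 ≤ t → ∀ (u v : Fin m → MvPolynomial (Fin 2) ℂ),
    (∀ j, coeff 0 (u j) = 0 ∧ (u j).support.card ≤ t) → (∀ j, coeff 0 (v j) = 0 ∧ (v j).support.card ≤ t) →
    ∀ (R : Expo → Expo → Prop) (S : Finset Expo),
      (∀ l ∈ S, ∃ ξ : Fin 2 → ℝ, ValidWeight u v ξ ∧ IsStrictTop ξ (logSupport u v) l ∧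
        ∀ e ∈ ((Finset.univ.biUnion fun j => (u j).support) ∪ Finset.univ.biUnion fun j => (v j).support),
        ∀ e' ∈ ((Finset.univ.biUnion fun j => (u j).support) ∪ Finset.univ.biUnion fun j => (v j).support),
          (R e e' ↔ wt ξ e ≤ wt ξ e')) →
      S.card ≤ 2 ^ (a * m) * (t + 2) ^ b

/-- **CO-SHADOW BOUND** — the per-cell MASS-CANCELLATION count: in one weight-order cell, the killed one-letter shadow of a family of
log-visible points has at most `2^{am}(t+2)^b` points. [this file] -/
def CoShadowBound : Prop :=
  ∃ a b : ℕ, ∀ (m t : ℕ), 2 ≤ t → ∀ (u v : Fin m → MvPolynomial (Fin 2) ℂ),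
    (∀ j, coeff 0 (u j) = 0 ∧ (u j).support.card ≤ t) → (∀ j, coeff 0 (v j) = 0 ∧ (v j).support.card ≤ t) →
    ∀ (R : Expo → Expo → Prop) (S : Finset Expo), IsCellFamily u v R S →
      (coShadow u v S).card ≤ 2 ^ (a * m) * (t + 2) ^ b

/-- Arithmetic: `2mt + X ≤ X · 2^m · (t+2)²` for `X = 2^{am}(t+2)^b ≥ 1`. [folklore] -/
theorem squeeze_arith (a b m t : ℕ) :
    2 * m * t + 2 ^ (a * m) * (t + 2) ^ b ≤ 2 ^ ((a + 1) * m) * (t + 2) ^ (b + 2) := by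
  set X : ℕ := 2 ^ (a * m) * (t + 2) ^ b with hX
  have hX1 : 1 ≤ X := Nat.one_le_iff_ne_zero.2 (by positivity)
  have h2m : m ≤ 2 ^ m := Nat.lt_two_pow_self.le
  have hP : 1 ≤ 2 ^ m := Nat.one_le_two_pow
  have hrw : 2 ^ ((a + 1) * m) * (t + 2) ^ (b + 2) = X * 2 ^ m * (t + 2) ^ 2 := by
    rw [hX, add_mul, one_mul, pow_add, pow_add]; ring
  rw [hrw]
  calc 2 * m * t + X ≤ 2 * 2 ^ m * t * X + X * 2 ^ m := by
        have h1 : 2 * m * t ≤ 2 * 2 ^ m * t * X :=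
          calc 2 * m * t ≤ 2 * 2 ^ m * t := by gcongr
            _ = 2 * 2 ^ m * t * 1 := (mul_one _).symm
            _ ≤ 2 * 2 ^ m * t * X := Nat.mul_le_mul_left _ hX1
        have h2 : X ≤ X * 2 ^ m :=
          calc X = X * 1 := (mul_one _).symm
            _ ≤ X * 2 ^ m := Nat.mul_le_mul_left _ hP
        exact add_le_add h1 h2
    _ ≤ 2 * 2 ^ m * t * X + X * 2 ^ m + (X * 2 ^ m * (t * t) + 2 * 2 ^ m * t * X + 3 * (X * 2 ^ m)) :=
        Nat.le_add_right _ _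
    _ = X * 2 ^ m * (t + 2) ^ 2 := by ring

/-- Arithmetic: `X · 2mt ≤ X · 2^m · (t+2)²`. [folklore] -/
theorem squeeze_arith' (a b m t : ℕ) :
    2 ^ (a * m) * (t + 2) ^ b * (2 * m * t) ≤ 2 ^ ((a + 1) * m) * (t + 2) ^ (b + 2) := by
  set X : ℕ := 2 ^ (a * m) * (t + 2) ^ b with hX
  have h2m : m ≤ 2 ^ m := Nat.lt_two_pow_self.le
  have hrw : 2 ^ ((a + 1) * m) * (t + 2) ^ (b + 2) = X * 2 ^ m * (t + 2) ^ 2 := by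
    rw [hX, add_mul, one_mul, pow_add, pow_add]; ring
  rw [hrw]
  calc X * (2 * m * t) ≤ X * (2 * 2 ^ m * t) := by gcongr
    _ ≤ X * (2 * 2 ^ m * t) + (X * 2 ^ m * (t * t) + 2 * (X * 2 ^ m * t) + 4 * (X * 2 ^ m)) := Nat.le_add_right _ _
    _ = X * 2 ^ m * (t + 2) ^ 2 := by ring

/-- **`CoShadowBound → PlanarCellBound`** (per-cell squeeze + arithmetic). [this file] -/
theorem planarCellBound_of_coShadowBound (h : CoShadowBound) : PlanarCellBound := by
  obtain ⟨a, b, hab⟩ := h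
  refine ⟨a + 1, b + 2, ?_⟩
  intro m t ht u v hu hv R S hS
  have hcell : IsCellFamily u v R S := hS
  calc S.card ≤ 2 * m * t + (coShadow u v S).card :=
        cell_corner_squeeze_sparse (fun j => (hu j).2) (fun j => (hv j).2) hcell
    _ ≤ 2 * m * t + 2 ^ (a * m) * (t + 2) ^ b := Nat.add_le_add_left (hab m t ht u v hu hv R S hcell) _
    _ ≤ 2 ^ ((a + 1) * m) * (t + 2) ^ (b + 2) := squeeze_arith a b m t

/-- **`PlanarCellBound → CoShadowBound`** (`#coShadow S ≤ #S · #letters`). [this file] -/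
theorem coShadowBound_of_planarCellBound (h : PlanarCellBound) : CoShadowBound := by
  obtain ⟨a, b, hab⟩ := h
  refine ⟨a + 1, b + 2, ?_⟩
  intro m t ht u v hu hv R S hS
  have hS' : S.card ≤ 2 ^ (a * m) * (t + 2) ^ b := hab m t ht u v hu hv R S hS
  calc (coShadow u v S).card ≤ S.card * (tailSupport u v).card := card_coShadow_le u v S
    _ ≤ 2 ^ (a * m) * (t + 2) ^ b * (2 * m * t) :=
        Nat.mul_le_mul hS' (card_tailSupport_le_two_mul u v t (fun j => (hu j).2) fun j => (hv j).2)
    _ ≤ 2 ^ ((a + 1) * m) * (t + 2) ^ (b + 2) := squeeze_arith' a b m t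

/-- **The target of the line of record is a mass-cancellation count:** `CoShadowBound ↔ PlanarCellBound`. [this file] -/
theorem coShadowBound_iff_planarCellBound : CoShadowBound ↔ PlanarCellBound :=
  ⟨planarCellBound_of_coShadowBound, coShadowBound_of_planarCellBound⟩

/-- **GENUINE-SHADOW BOUND** — the per-cell count of GENUINE cancellations one letter below the tops (`genShadow`). [this file] -/
def GenShadowBound : Prop :=
  ∃ a b : ℕ, ∀ (m t : ℕ), 2 ≤ t → ∀ (u v : Fin m → MvPolynomial (Fin 2) ℂ),
    (∀ j, coeff 0 (u j) = 0 ∧ (u j).support.card ≤ t) → (∀ j, coeff 0 (v j) = 0 ∧ (v j).support.card ≤ t) →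
    ∀ (R : Expo → Expo → Prop) (S : Finset Expo), IsCellFamily u v R S →
      (genShadow u v S).card ≤ 2 ^ (a * m) * (t + 2) ^ b

/-- **`GenShadowBound → PlanarCellBound`** (genuine per-cell squeeze + arithmetic). [this file] -/
theorem planarCellBound_of_genShadowBound (h : GenShadowBound) : PlanarCellBound := by
  obtain ⟨a, b, hab⟩ := h
  refine ⟨a + 1, b + 2, ?_⟩
  intro m t ht u v hu hv R S hS
  have hcell : IsCellFamily u v R S := hS
  calc S.card ≤ (S ∩ tailSupport u v).card + (genShadow u v S).card := (cell_corner_squeeze_genuine hcell).1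
    _ ≤ 2 * m * t + (genShadow u v S).card :=
        Nat.add_le_add_right ((Finset.card_le_card Finset.inter_subset_right).trans
          (card_tailSupport_le_two_mul u v t (fun j => (hu j).2) fun j => (hv j).2)) _
    _ ≤ 2 * m * t + 2 ^ (a * m) * (t + 2) ^ b := Nat.add_le_add_left (hab m t ht u v hu hv R S hcell) _
    _ ≤ 2 ^ ((a + 1) * m) * (t + 2) ^ (b + 2) := squeeze_arith a b m t

/-- **`CoShadowBound → GenShadowBound`** (`genShadow ⊆ coShadow`). [this file] -/
theorem genShadowBound_of_coShadowBound (h : CoShadowBound) : GenShadowBound := by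
  obtain ⟨a, b, hab⟩ := h
  exact ⟨a, b, fun m t ht u v hu hv R S hS =>
    (Finset.card_le_card (genShadow_subset_coShadow u v S)).trans (hab m t ht u v hu hv R S hS)⟩

/-- **The target of the line of record is a GENUINE mass-cancellation count:** `GenShadowBound ↔ PlanarCellBound`. [this file] -/
theorem genShadowBound_iff_planarCellBound : GenShadowBound ↔ PlanarCellBound :=
  ⟨planarCellBound_of_genShadowBound, fun h => genShadowBound_of_coShadowBound (coShadowBound_of_planarCellBound h)⟩

/-- **GLOBAL GENUINE-SHADOW BOUND** — no cells: «for every finite family of log-visible points, the genuine killed one-letter shadow has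
`≤ 2^{am}(t+2)^b` points». [this file] -/
def GlobalGenShadowBound : Prop :=
  ∃ a b : ℕ, ∀ (m t : ℕ), 2 ≤ t → ∀ (u v : Fin m → MvPolynomial (Fin 2) ℂ),
    (∀ j, coeff 0 (u j) = 0 ∧ (u j).support.card ≤ t) → (∀ j, coeff 0 (v j) = 0 ∧ (v j).support.card ≤ t) →
    ∀ S : Finset Expo, (∀ l ∈ S, l ∈ logVisible u v) → (genShadow u v S).card ≤ 2 ^ (a * m) * (t + 2) ^ b

/-- Arithmetic: `1 + 2mt + (2mt)² ≤ 4^m (t+2)³`. [folklore] -/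
theorem squeeze_arith3 (m t : ℕ) : 1 + 2 * m * t + (2 * m * t) * (2 * m * t) ≤ 4 ^ m * (t + 2) ^ 3 := by
  have h2 : m ≤ 2 ^ m := Nat.lt_two_pow_self.le
  have h4 : m * m ≤ 4 ^ m := by
    calc m * m ≤ 2 ^ m * 2 ^ m := Nat.mul_le_mul h2 h2
      _ = 4 ^ m := by rw [← mul_pow]; norm_num
  have h1 : 1 ≤ 4 ^ m := Nat.one_le_pow _ _ (by norm_num)
  have hm : m ≤ 4 ^ m := h2.trans (Nat.pow_le_pow_left (by norm_num) m)
  have e1 : (2 * m * t) * (2 * m * t) = 4 * (m * m) * (t * t) := by ring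
  have i1 : 4 * (m * m) * (t * t) ≤ 4 * 4 ^ m * (t * t) := by gcongr
  have i2 : 2 * m * t ≤ 2 * 4 ^ m * t := by gcongr
  have hY : 4 ^ m + 2 * 4 ^ m * t + 4 * 4 ^ m * (t * t) ≤ 4 ^ m * (t + 2) ^ 3 := by
    have e : 4 ^ m * (t + 2) ^ 3 = 8 * 4 ^ m + 12 * (4 ^ m * t) + 6 * (4 ^ m * (t * t)) + 4 ^ m * (t * t * t) := by ring
    rw [e]
    have := Nat.zero_le (4 ^ m * t); have := Nat.zero_le (4 ^ m * (t * t)); have := Nat.zero_le (4 ^ m * (t * t * t))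
    nlinarith
  calc 1 + 2 * m * t + (2 * m * t) * (2 * m * t) ≤ 4 ^ m + 2 * 4 ^ m * t + 4 * 4 ^ m * (t * t) := by
        rw [e1]; exact Nat.add_le_add (Nat.add_le_add h1 i2) i1
    _ ≤ 4 ^ m * (t + 2) ^ 3 := hY

/-- **`GlobalGenShadowBound → PlanarCellBound`** (a cell family consists of log-visible points; global squeeze + arithmetic, exponents
`(a + 2, b + 3)`). [this file] -/
theorem planarCellBound_of_globalGenShadowBound (h : GlobalGenShadowBound) : PlanarCellBound := by
  obtain ⟨a, b, hab⟩ := h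
  refine ⟨a + 2, b + 3, ?_⟩
  intro m t ht u v hu hv R S hS
  have hvis : ∀ l ∈ S, l ∈ logVisible u v := fun l hl => by
    obtain ⟨ξ, hval, htop, -⟩ := hS l hl
    exact ⟨ξ, hval, htop⟩
  have hsq := global_corner_squeeze_sparse (fun j => (hu j).2) (fun j => (hv j).2) hvis
  have hX := hab m t ht u v hu hv S hvis
  set X : ℕ := 2 ^ (a * m) * (t + 2) ^ b with hXdef
  have hX1 : 1 ≤ X := Nat.one_le_iff_ne_zero.2 (by positivity)
  have hA := squeeze_arith3 m t
  have hrw : 2 ^ ((a + 2) * m) * (t + 2) ^ (b + 3) = X * (4 ^ m * (t + 2) ^ 3) := by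
    rw [hXdef, add_mul, pow_add, pow_add, show (2 : ℕ) ^ (2 * m) = 4 ^ m by rw [pow_mul]; norm_num]
    ring
  rw [hrw]
  calc S.card ≤ 2 * m * t + (2 * m * t) * (2 * m * t) + (genShadow u v S).card := hsq
    _ ≤ 2 * m * t + (2 * m * t) * (2 * m * t) + X := Nat.add_le_add_left hX _
    _ ≤ X * (2 * m * t + (2 * m * t) * (2 * m * t)) + X :=
        Nat.add_le_add_right (Nat.le_mul_of_pos_left _ hX1) X
    _ = X * (1 + 2 * m * t + (2 * m * t) * (2 * m * t)) := by ring
    _ ≤ X * (4 ^ m * (t + 2) ^ 3) := Nat.mul_le_mul_left _ hA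

/-- **`GlobalGenShadowBound → TwoProducts`**: the crux of the line of record follows from ONE global mass-cancellation count, no cells.
[this file] -/
theorem twoProducts_of_globalGenShadowBound (h : GlobalGenShadowBound) :
    Summit.ValiantsHypothesis.ValiantsHypothesis.Theses.NewtonUnitEquations.TwoProducts :=
  twoProducts_of_planarCellBound (planarCellBound_of_globalGenShadowBound h)

/-- **`CoShadowBound → TwoProducts`**, via the landed transfer `twoProducts_of_planarCellBound` (p596451). [this file] -/
theorem twoProducts_of_coShadowBound (h : CoShadowBound) :
    Summit.ValiantsHypothesis.ValiantsHypothesis.Theses.NewtonUnitEquations.TwoProducts :=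
  twoProducts_of_planarCellBound (planarCellBound_of_coShadowBound h)

end Summit.ValiantsHypothesis.ValiantsHypothesis.Cruxes.TwoProducts.CornerSqueeze

end
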